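import Summits.Ventures.Crystal3D.Theorems.StickyWulffConstantCoaxialWallLawWordInstanceNoTop
import Summits.Ventures.Crystal3D.Theorems.StickyWulffConstantCoaxialWallLawExactCount
import Summits.Ventures.Crystal3D.Theorems.StickyWulffConstantCoaxialWallLawEndDichotomy
import Summits.Ventures.Crystal3D.Theorems.StickyWulffConstantCoaxialWallLawEndUnique
import Summits.Ventures.Crystal3D.Theorems.StickyWulffConstantCoaxialWallLawWordNoGlideMirror
import HarnessLib

/-!
# End accounting for the word automaton, census-free II: the in-plane instance — sources ≤ 78·#unsaturated + 220·rims

HONEST FRAMING. Part of the venture `Summits/Ventures/Crystal3D` (cell `crystal3d-full`), helper for the crux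
`CoaxialWallLaw` (stmt-Ventures-19481) of `route-Ventures-StickyWulffConstant`, REGISTERED line `WallLedgerF`
(planner cf-p1), open stub `stub_coaxialTwoSlabAdhesion` (general fillings).  Rung credit only; F-C1 not moved.

WHY THIS FILE.  `…ExactInstance.word_sources_le_lists_exact` (22·#unsaturated) charged every reachable end to its
own ball through the E1 rows C12-55 and A12-583; the A12-583 GLIDE STAR row is REFUTED
(`…GenericWallFloorGlideStarWitness.not_exactOnly_glideStar583`), so that count is conditional on a false
hypothesis.  This is its CENSUS-FREE replacement (planner cf-p1's option (A), INBOX 2026-08-28T04:19:27Z): the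
only named inputs are `KissingGap δ` and `KissingClassification δ` (through `…EndDichotomy`).

* `card_reached_ends_le_card_contacts` (abstract word data) — the states reached at a ball `b` from moving states
  number at most `deg b`: their predecessors `b − d κ` are DISTINCT contact neighbours of `b`
  (`word_reached_pred_ne`; word rigidity and glide non-return as hypotheses, discharged below for well-formed words).
* **`word_sources_le_lists_payers`** — hypotheses of `word_sources_le_lists_exact` with the two E1 rows replaced by
  `KissingGap δ`, `KissingClassification δ`.  The vertical tops of the inner bottom sample number at most
  `78 · #{z ∈ X : deg z ≤ 11, window} + 220·#rim_top + 220·#rim_bottom`: a reachable end at an UNSATURATED ball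
  is charged there (`≤ 12` per ball); a reachable end at a SATURATED ball has two distinct unsaturated contact
  neighbours (`word_reachable_end_two_payers`) and is charged `½` to each — an unsaturated ball has `≤ 11`
  contact neighbours, each carrying `≤ 12` reached states, so it receives `≤ ½·11·12 = 66`; `12 + 66 = 78`.

The sharing bound `11·12` is the trivial one; any certified bound on the number of saturated non-exact ends
touching one unsaturated ball divides the `66`.

WHAT THIS IS NOT: not the stub; the cell/twin assembly (constant `√6/312·sin θ`, census-free) is the next brick;
F-C1 not moved.
-/

noncomputable section

namespace Summit.Ventures.Crystal3D.Theorems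

open Summit.Ventures.Crystal3D Finset
open Literature.MathematicalPhysics.StatisticalMechanics (fccStacking)
open scoped InnerProductSpace

section Word

variable {X : Finset (EuclideanSpace ℝ (Fin 3))}
  {K : Type*} {F : K → (EuclideanSpace ℝ (Fin 3) ≃ₗᵢ[ℝ] EuclideanSpace ℝ (Fin 3))}
  {d : K → EuclideanSpace ℝ (Fin 3)} {next : K → EuclideanSpace ℝ (Fin 3) → K}
  {W : Finset (EuclideanSpace ℝ (Fin 3) × K)}
  {f : EuclideanSpace ℝ (Fin 3) × K → EuclideanSpace ℝ (Fin 3) × K}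

open scoped Classical in
/-- **Reached states at a ball number at most its contacts** (distinct predecessors).  See the module docstring. -/
theorem card_reached_ends_le_card_contacts (hX : ∀ p ∈ X, ∀ q ∈ X, p ≠ q → 1 ≤ dist p q)
    (hd : ∀ κ, ∃ u ∈ fccSlots, d κ = F κ u)
    (hdn : ∀ κ, ∃ m : EuclideanSpace ℝ (Fin 3), ‖m‖ = 1 ∧
      (∀ w ∈ fccSlots, ⟪F κ w, m⟫_ℝ = 0 ∨ ⟪F κ w, m⟫_ℝ = Real.sqrt (2 / 3) ∨ ⟪F κ w, m⟫_ℝ = -Real.sqrt (2 / 3)) ∧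
      ⟪d κ, m⟫_ℝ = Real.sqrt (2 / 3))
    (hmirror : ∀ κ (m : EuclideanSpace ℝ (Fin 3)), ‖m‖ = 1 →
      (∀ w ∈ fccSlots, ⟪F κ w, m⟫_ℝ = 0 ∨ ⟪F κ w, m⟫_ℝ = Real.sqrt (2 / 3) ∨ ⟪F κ w, m⟫_ℝ = -Real.sqrt (2 / 3)) →
      ⟪d κ, m⟫_ℝ = Real.sqrt (2 / 3) → ∀ x, F (next κ m) x = F κ x - (2 * ⟪F κ x, m⟫_ℝ) • m)
    (hdnext : ∀ κ (m : EuclideanSpace ℝ (Fin 3)), ‖m‖ = 1 →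
      (∀ w ∈ fccSlots, ⟪F κ w, m⟫_ℝ = 0 ∨ ⟪F κ w, m⟫_ℝ = Real.sqrt (2 / 3) ∨ ⟪F κ w, m⟫_ℝ = -Real.sqrt (2 / 3)) →
      ⟪d κ, m⟫_ℝ = Real.sqrt (2 / 3) → ⟪d (next κ m), m⟫_ℝ = Real.sqrt (2 / 3))
    (hW : ∀ v, v ∈ W ↔ (v.1 ∈ X ∧
      (∃ a ∈ fccSlots, ∃ a' ∈ fccSlots, ∃ a'' ∈ fccSlots,
        ⟪a, a'⟫_ℝ = 1 / 2 ∧ ⟪a, a''⟫_ℝ = 1 / 2 ∧ ⟪a', a''⟫_ℝ = 1 / 2 ∧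
        v.1 + F v.2 a ∈ X ∧ v.1 + F v.2 a' ∈ X ∧ v.1 + F v.2 a'' ∈ X) ∧
      v.1 - d v.2 ∈ X))
    (hf_full : ∀ v ∈ W, (∀ w ∈ fccSlots, v.1 + F v.2 w ∈ X) → f v = (v.1 + d v.2, v.2))
    (hf_cross : ∀ v ∈ W, ∀ m : EuclideanSpace ℝ (Fin 3), ‖m‖ = 1 →
      (∀ w ∈ fccSlots, ⟪F v.2 w, m⟫_ℝ = 0 ∨ ⟪F v.2 w, m⟫_ℝ = Real.sqrt (2 / 3) ∨ ⟪F v.2 w, m⟫_ℝ = -Real.sqrt (2 / 3)) →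
      (∀ w ∈ fccSlots, ⟪F v.2 w, m⟫_ℝ ≤ 0 → v.1 + F v.2 w ∈ X) →
      (∀ w ∈ fccSlots, ⟪F v.2 w, m⟫_ℝ < 0 → v.1 + (F v.2 w - (2 * ⟪F v.2 w, m⟫_ℝ) • m) ∈ X) →
      (∀ w ∈ fccSlots, 0 < ⟪F v.2 w, m⟫_ℝ → v.1 + F v.2 w ∉ X) →
      ⟪d v.2, m⟫_ℝ = Real.sqrt (2 / 3) → f v = (v.1 + d (next v.2 m), next v.2 m))
    (hf_glide : ∀ v ∈ W, ∀ m : EuclideanSpace ℝ (Fin 3), ‖m‖ = 1 →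
      (∀ w ∈ fccSlots, ⟪F v.2 w, m⟫_ℝ = 0 ∨ ⟪F v.2 w, m⟫_ℝ = Real.sqrt (2 / 3) ∨ ⟪F v.2 w, m⟫_ℝ = -Real.sqrt (2 / 3)) →
      (∀ w ∈ fccSlots, ⟪F v.2 w, m⟫_ℝ ≤ 0 → v.1 + F v.2 w ∈ X) →
      (∀ w ∈ fccSlots, ⟪F v.2 w, m⟫_ℝ < 0 → v.1 + (F v.2 w - (2 * ⟪F v.2 w, m⟫_ℝ) • m) ∈ X) →
      (∀ w ∈ fccSlots, 0 < ⟪F v.2 w, m⟫_ℝ → v.1 + F v.2 w ∉ X) →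
      ⟪d v.2, m⟫_ℝ = 0 → f v = (v.1 + d v.2, v.2))
    (hrigid : ∀ κ₁ κ₂ : K, (∃ a ∈ fccSlots, ∃ a' ∈ fccSlots, ∃ a'' ∈ fccSlots,
        ⟪a, a'⟫_ℝ = 1 / 2 ∧ ⟪a, a''⟫_ℝ = 1 / 2 ∧ ⟪a', a''⟫_ℝ = 1 / 2 ∧
        (∃ w ∈ fccSlots, F κ₂ w = F κ₁ a) ∧ (∃ w ∈ fccSlots, F κ₂ w = F κ₁ a') ∧
        (∃ w ∈ fccSlots, F κ₂ w = F κ₁ a'')) → κ₁ = κ₂)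
    (hnoglide : ∀ (κ κ' : K) (m : EuclideanSpace ℝ (Fin 3)), ‖m‖ = 1 →
      (∀ w ∈ fccSlots, ⟪F κ w, m⟫_ℝ = 0 ∨ ⟪F κ w, m⟫_ℝ = Real.sqrt (2 / 3) ∨ ⟪F κ w, m⟫_ℝ = -Real.sqrt (2 / 3)) →
      ⟪d κ, m⟫_ℝ = 0 →
      (F κ' : EuclideanSpace ℝ (Fin 3) → EuclideanSpace ℝ (Fin 3)) '' ↑fccSlots ≠
        (fun x => F κ x - (2 * ⟪F κ x, m⟫_ℝ) • m) '' ↑fccSlots)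
    (b : EuclideanSpace ℝ (Fin 3)) :
    (W.filter fun v => v.1 = b ∧ ∃ u ∈ W,
        ((∀ w ∈ fccSlots, u.1 + F u.2 w ∈ X) ∨
          ∃ m : EuclideanSpace ℝ (Fin 3), ‖m‖ = 1 ∧
            (∀ w ∈ fccSlots, ⟪F u.2 w, m⟫_ℝ = 0 ∨ ⟪F u.2 w, m⟫_ℝ = Real.sqrt (2 / 3) ∨ ⟪F u.2 w, m⟫_ℝ = -Real.sqrt (2 / 3)) ∧
            (∀ w ∈ fccSlots, ⟪F u.2 w, m⟫_ℝ ≤ 0 → u.1 + F u.2 w ∈ X) ∧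
            (∀ w ∈ fccSlots, ⟪F u.2 w, m⟫_ℝ < 0 → u.1 + (F u.2 w - (2 * ⟪F u.2 w, m⟫_ℝ) • m) ∈ X) ∧
            (∀ w ∈ fccSlots, 0 < ⟪F u.2 w, m⟫_ℝ → u.1 + F u.2 w ∉ X) ∧
            (⟪d u.2, m⟫_ℝ = Real.sqrt (2 / 3) ∨ ⟪d u.2, m⟫_ℝ = 0)) ∧ f u = v).card ≤
      (X.filter fun q => dist b q = 1).card := by
  set mov : EuclideanSpace ℝ (Fin 3) × K → Prop := fun u => (∀ w ∈ fccSlots, u.1 + F u.2 w ∈ X) ∨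
      ∃ m : EuclideanSpace ℝ (Fin 3), ‖m‖ = 1 ∧
        (∀ w ∈ fccSlots, ⟪F u.2 w, m⟫_ℝ = 0 ∨ ⟪F u.2 w, m⟫_ℝ = Real.sqrt (2 / 3) ∨ ⟪F u.2 w, m⟫_ℝ = -Real.sqrt (2 / 3)) ∧
        (∀ w ∈ fccSlots, ⟪F u.2 w, m⟫_ℝ ≤ 0 → u.1 + F u.2 w ∈ X) ∧
        (∀ w ∈ fccSlots, ⟪F u.2 w, m⟫_ℝ < 0 → u.1 + (F u.2 w - (2 * ⟪F u.2 w, m⟫_ℝ) • m) ∈ X) ∧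
        (∀ w ∈ fccSlots, 0 < ⟪F u.2 w, m⟫_ℝ → u.1 + F u.2 w ∉ X) ∧
        (⟪d u.2, m⟫_ℝ = Real.sqrt (2 / 3) ∨ ⟪d u.2, m⟫_ℝ = 0) with hmov
  show (W.filter fun v => v.1 = b ∧ ∃ u ∈ W, mov u ∧ f u = v).card ≤ (X.filter fun q => dist b q = 1).card
  refine Finset.card_le_card_of_injOn (fun v => v.1 - d v.2) ?_ ?_
  · intro v hv
    obtain ⟨hvW, hvb, -⟩ := mem_filter.1 hv
    obtain ⟨-, -, hpred⟩ := (hW v).1 hvW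
    obtain ⟨u', hu', hdu⟩ := hd v.2
    refine mem_coe.2 (mem_filter.2 ⟨hpred, ?_⟩)
    rw [← hvb, dist_eq_norm, sub_sub_cancel, hdu, LinearIsometryEquiv.norm_map, norm_eq_one_of_mem_fccSlots hu']
  · intro v hv v' hv' heq
    obtain ⟨-, -, u₁, hu₁, hm₁, hfu₁⟩ := mem_filter.1 (mem_coe.1 hv)
    obtain ⟨-, -, u₂, hu₂, hm₂, hfu₂⟩ := mem_filter.1 (mem_coe.1 hv')
    by_contra hne
    rw [← hfu₁, ← hfu₂] at hne heq
    exact word_reached_pred_ne hX hd hdn hmirror hdnext hW hf_full hf_cross hf_glide hrigid hnoglide hu₁ hu₂ hm₁ hm₂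
      hne heq

end Word

section Instance

variable {X : Finset (EuclideanSpace ℝ (Fin 3))}
  {F : List (EuclideanSpace ℝ (Fin 3)) → (EuclideanSpace ℝ (Fin 3) ≃ₗᵢ[ℝ] EuclideanSpace ℝ (Fin 3))}
  {u : List (EuclideanSpace ℝ (Fin 3)) → EuclideanSpace ℝ (Fin 3)}
  {WF : List (EuclideanSpace ℝ (Fin 3)) → Prop}
  {next : List (EuclideanSpace ℝ (Fin 3)) → EuclideanSpace ℝ (Fin 3) → List (EuclideanSpace ℝ (Fin 3))}
  {P₁ P' P₂ : Finset (EuclideanSpace ℝ (Fin 3))} {t₁ t₂ : EuclideanSpace ℝ (Fin 3)} {R₀ h ρ : ℝ}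

open scoped Classical in
/-- **The census-free in-plane count, instantiated for well-formed words.**  See the module docstring. -/
theorem word_sources_le_lists_payers {δ : ℝ} (hg : KissingGap δ) (hc : KissingClassification δ)
    (hX : ∀ p ∈ X, ∀ q ∈ X, p ≠ q → 1 ≤ dist p q)
    (hFc : ∀ μ κ, F (μ :: κ) = ((ℝ ∙ μ)ᗮ.reflection).trans (F κ))
    (hu : ∀ κ, u κ ∈ fccSlots) (huc : ∀ μ κ, u (μ :: κ) = -u κ)
    (hWF0 : WF [])
    (hWFc : ∀ μ κ, WF (μ :: κ) ↔ (WF κ ∧ ‖μ‖ = 1 ∧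
      (∀ w ∈ fccSlots, ⟪w, μ⟫_ℝ = 0 ∨ ⟪w, μ⟫_ℝ = Real.sqrt (2 / 3) ∨ ⟪w, μ⟫_ℝ = -Real.sqrt (2 / 3)) ∧
      ⟪u κ, μ⟫_ℝ = Real.sqrt (2 / 3) ∧ ∀ μ' κ', κ = μ' :: κ' → μ' ≠ -μ))
    (hnext_pop : ∀ μ κ' (m : EuclideanSpace ℝ (Fin 3)), (F (μ :: κ')).symm m = -μ → next (μ :: κ') m = κ')
    (hnext_push : ∀ κ (m : EuclideanSpace ℝ (Fin 3)), (∀ μ κ', κ = μ :: κ' → (F κ).symm m ≠ -μ) →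
      next κ m = (F κ).symm m :: κ)
    -- the in-plane root and the top grain's frame (a twin across the `m`-planes)
    {m : EuclideanSpace ℝ (Fin 3)} (hm : ‖m‖ = 1)
    (hmenu : ∀ w ∈ fccSlots, ⟪w, m⟫_ℝ = 0 ∨ ⟪w, m⟫_ℝ = Real.sqrt (2 / 3) ∨ ⟪w, m⟫_ℝ = -Real.sqrt (2 / 3))
    (horth : ⟪u [], m⟫_ℝ = 0)
    (G₂ : EuclideanSpace ℝ (Fin 3) ≃ₗᵢ[ℝ] EuclideanSpace ℝ (Fin 3))
    (hG₂ : (G₂ : EuclideanSpace ℝ (Fin 3) → EuclideanSpace ℝ (Fin 3)) '' ↑fccSlots =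
      (fun x => F [] (x - (2 * ⟪x, m⟫_ℝ) • m)) '' ↑fccSlots)
    (hup : 0 < (F [] (u [])) 2)
    -- the cell
    (hR₀ : 3 ≤ R₀) (hρ : R₀ ≤ ρ)
    (hcell : ∀ p ∈ X, -(2 * R₀) ≤ p 2 ∧ p 2 ≤ h + 2 * R₀ ∧ p 0 ^ 2 + p 1 ^ 2 ≤ ρ ^ 2)
    (hP₁X : P₁ ⊆ X) (hP₂X : P₂ ⊆ X)
    (hP₁ : ∀ p, p ∈ P₁ ↔ (p ∈ (fun q => F [] q + t₁) '' fccStacking 1 (Real.sqrt (2 / 3)) ∧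
      -(2 * R₀) ≤ p 2 ∧ p 2 ≤ -R₀ ∧ p 0 ^ 2 + p 1 ^ 2 ≤ ρ ^ 2))
    (hP' : ∀ p, p ∈ P' ↔ (p ∈ (fun q => F [] q + t₁) '' fccStacking 1 (Real.sqrt (2 / 3)) ∧
      -(2 * R₀) + 1 ≤ p 2 ∧ p 2 ≤ -R₀ - 1 ∧ p 0 ^ 2 + p 1 ^ 2 ≤ (ρ - 1) ^ 2))
    (hP'full : ∀ p ∈ P', ∀ w ∈ fccSlots, p + F [] w ∈ X)
    (hP₂ : ∀ p, p ∈ P₂ ↔ (p ∈ (fun q => G₂ q + t₂) '' fccStacking 1 (Real.sqrt (2 / 3)) ∧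
      h + R₀ ≤ p 2 ∧ p 2 ≤ h + 2 * R₀ ∧ p 0 ^ 2 + p 1 ^ 2 ≤ ρ ^ 2)) :
    (P'.filter fun p => (∀ w ∈ fccSlots, p + F [] w ∈ X) ∧
        -R₀ - 1 < (p + F [] (u [])) 2 ∧ (p + F [] (u [])) 2 < h + R₀ + 1).card ≤
      78 * (X.filter fun z => (X.filter fun q => dist z q = 1).card ≤ 11 ∧
          -R₀ - 1 - 1 ≤ z 2 ∧ z 2 ≤ h + R₀ + 1 + 1).card +
      220 * (X.filter fun s => h + R₀ + 1 ≤ s 2 ∧ s 2 ≤ h + R₀ + 1 + 1 ∧ (ρ - 2) ^ 2 < s 0 ^ 2 + s 1 ^ 2).card +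
      220 * (X.filter fun s => -R₀ - 1 - 1 ≤ s 2 ∧ s 2 < -R₀ - 1 ∧ (ρ - 1) ^ 2 < s 0 ^ 2 + s 1 ^ 2).card := by
  -- the class data on the subtype of well-formed words
  set F' : {κ : List (EuclideanSpace ℝ (Fin 3)) // WF κ} →
      (EuclideanSpace ℝ (Fin 3) ≃ₗᵢ[ℝ] EuclideanSpace ℝ (Fin 3)) := fun κ => F κ.1 with hF'
  set d' : {κ : List (EuclideanSpace ℝ (Fin 3)) // WF κ} → EuclideanSpace ℝ (Fin 3) :=
    fun κ => F κ.1 (u κ.1) with hd'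
  set next' : {κ : List (EuclideanSpace ℝ (Fin 3)) // WF κ} → EuclideanSpace ℝ (Fin 3) →
      {κ : List (EuclideanSpace ℝ (Fin 3)) // WF κ} := fun κ m =>
    @dite _ (WF (next κ.1 m)) (Classical.propDecidable _) (fun hw => ⟨next κ.1 m, hw⟩) (fun _ => κ) with hnext'
  set root : {κ : List (EuclideanSpace ℝ (Fin 3)) // WF κ} := ⟨[], hWF0⟩ with hroot_def
  -- the class change along a crossing normal
  have hspec : ∀ (κ : {κ : List (EuclideanSpace ℝ (Fin 3)) // WF κ}) (m : EuclideanSpace ℝ (Fin 3)), ‖m‖ = 1 →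
      (∀ w ∈ fccSlots, ⟪F' κ w, m⟫_ℝ = 0 ∨ ⟪F' κ w, m⟫_ℝ = Real.sqrt (2 / 3) ∨ ⟪F' κ w, m⟫_ℝ = -Real.sqrt (2 / 3)) →
      ⟪d' κ, m⟫_ℝ = Real.sqrt (2 / 3) →
      (next' κ m).1 = next κ.1 m ∧ (∀ x, F (next κ.1 m) x = F κ.1 x - (2 * ⟪F κ.1 x, m⟫_ℝ) • m) ∧
        ⟪F (next κ.1 m) (u (next κ.1 m)), m⟫_ℝ = Real.sqrt (2 / 3) ∧ next (next κ.1 m) m = κ.1 := by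
    intro κ m hm hmenu hdm
    obtain ⟨hwf, hfr, hdir, hinv⟩ := word_next_spec hFc huc hWFc hnext_pop hnext_push κ.2 hm hmenu hdm
    refine ⟨?_, hfr, hdir, hinv⟩
    simp only [hnext']
    rw [dif_pos hwf]
  have hmirror : ∀ (κ : {κ : List (EuclideanSpace ℝ (Fin 3)) // WF κ}) (m : EuclideanSpace ℝ (Fin 3)), ‖m‖ = 1 →
      (∀ w ∈ fccSlots, ⟪F' κ w, m⟫_ℝ = 0 ∨ ⟪F' κ w, m⟫_ℝ = Real.sqrt (2 / 3) ∨ ⟪F' κ w, m⟫_ℝ = -Real.sqrt (2 / 3)) →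
      ⟪d' κ, m⟫_ℝ = Real.sqrt (2 / 3) → ∀ x, F' (next' κ m) x = F' κ x - (2 * ⟪F' κ x, m⟫_ℝ) • m := by
    intro κ m hm hmenu hdm x
    obtain ⟨h1, hfr, -, -⟩ := hspec κ m hm hmenu hdm
    show F (next' κ m).1 x = F κ.1 x - (2 * ⟪F κ.1 x, m⟫_ℝ) • m
    rw [h1]; exact hfr x
  have hinv : ∀ (κ : {κ : List (EuclideanSpace ℝ (Fin 3)) // WF κ}) (m : EuclideanSpace ℝ (Fin 3)), ‖m‖ = 1 →
      (∀ w ∈ fccSlots, ⟪F' κ w, m⟫_ℝ = 0 ∨ ⟪F' κ w, m⟫_ℝ = Real.sqrt (2 / 3) ∨ ⟪F' κ w, m⟫_ℝ = -Real.sqrt (2 / 3)) →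
      ⟪d' κ, m⟫_ℝ = Real.sqrt (2 / 3) → next' (next' κ m) m = κ := by
    intro κ m hm hmenu hdm
    obtain ⟨h1, -, -, hback⟩ := hspec κ m hm hmenu hdm
    apply Subtype.ext
    have h2 : (next' (next' κ m) m).1 = next (next' κ m).1 m := by
      simp only [hnext']
      rw [dif_pos]
      rw [h1, hback]; exact κ.2
    rw [h2, h1, hback]
  have hdnext : ∀ (κ : {κ : List (EuclideanSpace ℝ (Fin 3)) // WF κ}) (m : EuclideanSpace ℝ (Fin 3)), ‖m‖ = 1 →
      (∀ w ∈ fccSlots, ⟪F' κ w, m⟫_ℝ = 0 ∨ ⟪F' κ w, m⟫_ℝ = Real.sqrt (2 / 3) ∨ ⟪F' κ w, m⟫_ℝ = -Real.sqrt (2 / 3)) →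
      ⟪d' κ, m⟫_ℝ = Real.sqrt (2 / 3) → ⟪d' (next' κ m), m⟫_ℝ = Real.sqrt (2 / 3) := by
    intro κ m hm hmenu hdm
    obtain ⟨h1, -, hdir, -⟩ := hspec κ m hm hmenu hdm
    show ⟪F (next' κ m).1 (u (next' κ m).1), m⟫_ℝ = Real.sqrt (2 / 3)
    rw [h1]; exact hdir
  have hd : ∀ κ : {κ : List (EuclideanSpace ℝ (Fin 3)) // WF κ}, ∃ u' ∈ fccSlots, d' κ = F' κ u' :=
    fun κ => ⟨u κ.1, hu κ.1, rfl⟩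
  have hdn : ∀ κ : {κ : List (EuclideanSpace ℝ (Fin 3)) // WF κ}, ∃ m : EuclideanSpace ℝ (Fin 3), ‖m‖ = 1 ∧
      (∀ w ∈ fccSlots, ⟪F' κ w, m⟫_ℝ = 0 ∨ ⟪F' κ w, m⟫_ℝ = Real.sqrt (2 / 3) ∨ ⟪F' κ w, m⟫_ℝ = -Real.sqrt (2 / 3)) ∧
      ⟪d' κ, m⟫_ℝ = Real.sqrt (2 / 3) := fun κ => exists_menuNormal_far (F κ.1) (hu κ.1)
  -- rigidity: the slot dozen determines the word
  have hinjK : ∀ κ κ' : {κ : List (EuclideanSpace ℝ (Fin 3)) // WF κ},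
      (F' κ : EuclideanSpace ℝ (Fin 3) → EuclideanSpace ℝ (Fin 3)) '' ↑fccSlots =
      (F' κ' : EuclideanSpace ℝ (Fin 3) → EuclideanSpace ℝ (Fin 3)) '' ↑fccSlots → κ = κ' :=
    fun κ κ' himg => Subtype.ext (word_eq_of_image_eq hFc huc hWFc κ.2 κ'.2 himg)
  have hrig : ∀ κ κ' : {κ : List (EuclideanSpace ℝ (Fin 3)) // WF κ},
      (∃ a ∈ fccSlots, ∃ a' ∈ fccSlots, ∃ a'' ∈ fccSlots,
        ⟪a, a'⟫_ℝ = 1 / 2 ∧ ⟪a, a''⟫_ℝ = 1 / 2 ∧ ⟪a', a''⟫_ℝ = 1 / 2 ∧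
        (∃ w ∈ fccSlots, F' κ' w = F' κ a) ∧ (∃ w ∈ fccSlots, F' κ' w = F' κ a') ∧
        (∃ w ∈ fccSlots, F' κ' w = F' κ a'')) → κ = κ' :=
    fun κ κ' htri => Subtype.ext (word_eq_of_triangle hFc huc hWFc κ.2 κ'.2 htri)
  -- glide non-return for well-formed words
  have hnoglide : ∀ (κ κ' : {κ : List (EuclideanSpace ℝ (Fin 3)) // WF κ}) (m : EuclideanSpace ℝ (Fin 3)), ‖m‖ = 1 →
      (∀ w ∈ fccSlots, ⟪F' κ w, m⟫_ℝ = 0 ∨ ⟪F' κ w, m⟫_ℝ = Real.sqrt (2 / 3) ∨ ⟪F' κ w, m⟫_ℝ = -Real.sqrt (2 / 3)) →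
      ⟪d' κ, m⟫_ℝ = 0 →
      (F' κ' : EuclideanSpace ℝ (Fin 3) → EuclideanSpace ℝ (Fin 3)) '' ↑fccSlots ≠
        (fun x => F' κ x - (2 * ⟪F' κ x, m⟫_ℝ) • m) '' ↑fccSlots := by
    intro κ κ' m hm hmenu hdm
    set μ : EuclideanSpace ℝ (Fin 3) := (F κ.1).symm m with hμ
    have hFμ : F κ.1 μ = m := by rw [hμ, LinearIsometryEquiv.apply_symm_apply]
    have hμ1 : ‖μ‖ = 1 := by rw [hμ, LinearIsometryEquiv.norm_map, hm]
    have hμmenu : ∀ w ∈ fccSlots, ⟪w, μ⟫_ℝ = 0 ∨ ⟪w, μ⟫_ℝ = Real.sqrt (2 / 3) ∨ ⟪w, μ⟫_ℝ = -Real.sqrt (2 / 3) := by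
      intro w hw; rw [← LinearIsometryEquiv.inner_map_map (F κ.1) w μ, hFμ]; exact hmenu w hw
    have horth : ⟪u κ.1, μ⟫_ℝ = 0 := by
      rw [← LinearIsometryEquiv.inner_map_map (F κ.1) (u κ.1) μ, hFμ]; exact hdm
    have key := word_image_ne_glideMirror hFc huc hWFc κ.2 hμ1 hμmenu horth κ'.2
    have e : (fun x => F κ.1 (x - (2 * ⟪x, μ⟫_ℝ) • μ)) = fun x => F' κ x - (2 * ⟪F' κ x, m⟫_ℝ) • m := by
      funext x
      show F κ.1 (x - (2 * ⟪x, μ⟫_ℝ) • μ) = F κ.1 x - (2 * ⟪F κ.1 x, m⟫_ℝ) • m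
      rw [← hFμ, mirror_conj]
    rw [e] at key; exact key
  -- the certified states and the move map
  obtain ⟨W, hW, hmult⟩ := exists_certified_states (F := F') (d := d') hX hinjK
  obtain ⟨f, hf_full, hf_cross, hf_glide⟩ := exists_word_move_map X F' d' next'
  -- no well-formed word carries the top grain's slots (in-plane root)
  have hnotop : ∀ κ : {κ : List (EuclideanSpace ℝ (Fin 3)) // WF κ},
      ¬ (∃ a ∈ fccSlots, ∃ a' ∈ fccSlots, ∃ a'' ∈ fccSlots,
        ⟪a, a'⟫_ℝ = 1 / 2 ∧ ⟪a, a''⟫_ℝ = 1 / 2 ∧ ⟪a', a''⟫_ℝ = 1 / 2 ∧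
        (∃ w ∈ fccSlots, G₂ w = F' κ a) ∧ (∃ w ∈ fccSlots, G₂ w = F' κ a') ∧
        (∃ w ∈ fccSlots, G₂ w = F' κ a'')) :=
    fun κ => word_noTop_of_inner_zero hFc huc hWFc hm hmenu horth G₂ hG₂ κ.2
  -- no certified state sits on a full `G₂`-shell (it would have a triangle in `G₂`'s slots)
  have hPexcl : ∀ v ∈ W, True → v.1 ∈ P₂ → (∀ w ∈ fccSlots, v.1 + G₂ w ∈ X) → False := by
    intro v hv _ _ hGfull
    obtain ⟨-, ⟨a, ha, a', ha', a'', ha'', i1, i2, i3, h1, h2, h3⟩, -⟩ := (hW v).1 hv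
    refine hnotop v.2 ⟨a, ha, a', ha', a'', ha'', i1, i2, i3, ?_, ?_, ?_⟩
    · exact shell_slot_of_full hX G₂ hGfull h1 (by rw [LinearIsometryEquiv.norm_map, norm_eq_one_of_mem_fccSlots ha])
    · exact shell_slot_of_full hX G₂ hGfull h2 (by rw [LinearIsometryEquiv.norm_map, norm_eq_one_of_mem_fccSlots ha'])
    · exact shell_slot_of_full hX G₂ hGfull h3 (by rw [LinearIsometryEquiv.norm_map, norm_eq_one_of_mem_fccSlots ha''])
  -- the abstract exact count with the trivial state invariant
  have key := word_sources_le_exact (root := root) (G₂ := G₂) (P := fun _ => True) hX hd hdn hmirror hinv hdnext hW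
    hmult (fun v _ => hf_full v) (fun v _ => hf_cross v) (fun v _ => hf_glide v)
    (fun κ hκ => hrig κ root hκ) hup (fun _ _ _ => trivial) (fun _ _ _ => trivial)
    (fun _ _ _ _ _ _ _ => trivial) hPexcl hR₀ hρ hcell hP₁X hP₂X hP₁ hP' hP'full hP₂
  -- moving states, in membership form
  set mov : EuclideanSpace ℝ (Fin 3) × {κ : List (EuclideanSpace ℝ (Fin 3)) // WF κ} → Prop := fun v =>
    (∀ w ∈ fccSlots, v.1 + F' v.2 w ∈ X) ∨
      ∃ m : EuclideanSpace ℝ (Fin 3), ‖m‖ = 1 ∧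
        (∀ w ∈ fccSlots, ⟪F' v.2 w, m⟫_ℝ = 0 ∨ ⟪F' v.2 w, m⟫_ℝ = Real.sqrt (2 / 3) ∨ ⟪F' v.2 w, m⟫_ℝ = -Real.sqrt (2 / 3)) ∧
        (∀ w ∈ fccSlots, ⟪F' v.2 w, m⟫_ℝ ≤ 0 → v.1 + F' v.2 w ∈ X) ∧
        (∀ w ∈ fccSlots, ⟪F' v.2 w, m⟫_ℝ < 0 → v.1 + (F' v.2 w - (2 * ⟪F' v.2 w, m⟫_ℝ) • m) ∈ X) ∧
        (∀ w ∈ fccSlots, 0 < ⟪F' v.2 w, m⟫_ℝ → v.1 + F' v.2 w ∉ X) ∧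
        (⟪d' v.2, m⟫_ℝ = Real.sqrt (2 / 3) ∨ ⟪d' v.2, m⟫_ℝ = 0) with hmov
  -- the end set of the abstract count, in membership form
  obtain ⟨E, hkey, hEmem⟩ : ∃ E : Finset (EuclideanSpace ℝ (Fin 3) × {κ : List (EuclideanSpace ℝ (Fin 3)) // WF κ}),
      (P'.filter fun p => (∀ w ∈ fccSlots, p + F [] w ∈ X) ∧
          -R₀ - 1 < (p + F [] (u [])) 2 ∧ (p + F [] (u [])) 2 < h + R₀ + 1).card ≤
        E.card +
        220 * (X.filter fun s => h + R₀ + 1 ≤ s 2 ∧ s 2 ≤ h + R₀ + 1 + 1 ∧ (ρ - 2) ^ 2 < s 0 ^ 2 + s 1 ^ 2).card +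
        220 * (X.filter fun s => -R₀ - 1 - 1 ≤ s 2 ∧ s 2 < -R₀ - 1 ∧ (ρ - 1) ^ 2 < s 0 ^ 2 + s 1 ^ 2).card ∧
      ∀ v, v ∈ E ↔ v ∈ W ∧ (-R₀ - 1 ≤ v.1 2 ∧ v.1 2 < h + R₀ + 1 ∧ ¬ mov v ∧ True ∧
        ∃ u ∈ W, mov u ∧ f u = v) :=
    ⟨_, key, fun v => by simp only [Finset.mem_filter, hmov]⟩
  set PAY := X.filter fun z => (X.filter fun q => dist z q = 1).card ≤ 11 ∧
    -R₀ - 1 - 1 ≤ z 2 ∧ z 2 ≤ h + R₀ + 1 + 1 with hPAY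
  -- the states reached at any ball: at most `deg ≤ 12`
  obtain ⟨Rb, hRbcard, hRbmem⟩ : ∃ Rb : EuclideanSpace ℝ (Fin 3) →
      Finset (EuclideanSpace ℝ (Fin 3) × {κ : List (EuclideanSpace ℝ (Fin 3)) // WF κ}),
      (∀ b, (Rb b).card ≤ (X.filter fun q => dist b q = 1).card) ∧
      ∀ b v, v ∈ Rb b ↔ v ∈ W ∧ (v.1 = b ∧ ∃ u ∈ W, mov u ∧ f u = v) :=
    ⟨_, fun b => card_reached_ends_le_card_contacts hX hd hdn hmirror hdnext hW (fun v _ => hf_full v)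
      (fun v _ => hf_cross v) (fun v _ => hf_glide v) hrig hnoglide b, fun b v => by simp only [Finset.mem_filter, hmov]⟩
  have hRb12 : ∀ b, (Rb b).card ≤ 12 := fun b => (hRbcard b).trans (card_filter_dist_eq_one_le_twelve X hX b)
  have hERb : ∀ v ∈ E, v ∈ Rb v.1 := by
    intro v hv
    obtain ⟨hvW, -, -, -, -, hu⟩ := (hEmem v).1 hv
    exact (hRbmem v.1 v).2 ⟨hvW, rfl, hu⟩
  -- an end ball is in the window; a contact neighbour of it is in the widened window
  have hEwin : ∀ v ∈ E, -R₀ - 1 ≤ v.1 2 ∧ v.1 2 < h + R₀ + 1 := fun v hv => ⟨((hEmem v).1 hv).2.1, ((hEmem v).1 hv).2.2.1⟩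
  have hnbwin : ∀ v ∈ E, ∀ z : EuclideanSpace ℝ (Fin 3), dist v.1 z = 1 →
      -R₀ - 1 - 1 ≤ z 2 ∧ z 2 ≤ h + R₀ + 1 + 1 := by
    intro v hv z hdz
    obtain ⟨h1, h2⟩ := hEwin v hv
    have hsq := sq_sub_apply_le_dist_sq z v.1 2
    rw [dist_comm, hdz, one_pow] at hsq
    have habs : |z 2 - v.1 2| ≤ 1 := by rw [← sq_le_one_iff_abs_le_one]; exact hsq
    obtain ⟨hl, hu'⟩ := abs_le.1 habs
    exact ⟨by linarith, by linarith⟩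
  -- split the ends: unsaturated own ball / saturated own ball
  set Eu := E.filter fun v => (X.filter fun q => dist v.1 q = 1).card ≤ 11 with hEu
  set Es := E.filter fun v => ¬ (X.filter fun q => dist v.1 q = 1).card ≤ 11 with hEs
  have hEsplit : E.card = Eu.card + Es.card := by
    rw [hEu, hEs]; exact (card_filter_add_card_filter_not _).symm
  -- (1) ends at unsaturated balls: `≤ 12` per payer
  have hEu_le : Eu.card ≤ 12 * PAY.card := by
    have hcov : Eu ⊆ PAY.biUnion fun z => Rb z := by
      intro v hv
      obtain ⟨hvE, hdeg⟩ := mem_filter.1 hv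
      obtain ⟨h1, h2⟩ := hEwin v hvE
      rw [mem_biUnion]
      refine ⟨v.1, mem_filter.2 ⟨((hW v).1 ((hEmem v).1 hvE).1).1, hdeg, by linarith, by linarith⟩, hERb v hvE⟩
    calc Eu.card ≤ (PAY.biUnion fun z => Rb z).card := card_le_card hcov
      _ ≤ ∑ z ∈ PAY, (Rb z).card := card_biUnion_le
      _ ≤ ∑ z ∈ PAY, 12 := sum_le_sum fun z _ => hRb12 z
      _ = 12 * PAY.card := by rw [sum_const, smul_eq_mul, mul_comm]
  -- (2) ends at saturated balls: two unsaturated contact neighbours each, `≤ 11·12` per payer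
  have hEs_two : ∀ v ∈ Es, 2 ≤ (PAY.filter fun z => dist v.1 z = 1).card := by
    intro v hv
    obtain ⟨hvE, hdeg⟩ := mem_filter.1 hv
    obtain ⟨hvW, -, -, hnm, -, u', hu'W, hum, hfu⟩ := (hEmem v).1 hvE
    have hnm' : ¬ mov (f u') := by rw [hfu]; exact hnm
    rcases word_reachable_end_two_payers hg hc hX hd hdn hmirror hdnext hW (fun v _ => hf_full v)
        (fun v _ => hf_cross v) (fun v _ => hf_glide v) hu'W hum hnm' with h11 | ⟨z₁, hz₁, z₂, hz₂, hne, hd₁, hd₂, hc₁, hc₂⟩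
    · rw [hfu] at h11; exact absurd h11 hdeg
    · rw [hfu] at hd₁ hd₂
      have hz₁P : z₁ ∈ PAY.filter fun z => dist v.1 z = 1 :=
        mem_filter.2 ⟨mem_filter.2 ⟨hz₁, hc₁, hnbwin v hvE z₁ hd₁⟩, hd₁⟩
      have hz₂P : z₂ ∈ PAY.filter fun z => dist v.1 z = 1 :=
        mem_filter.2 ⟨mem_filter.2 ⟨hz₂, hc₂, hnbwin v hvE z₂ hd₂⟩, hd₂⟩
      calc 2 = ({z₁, z₂} : Finset _).card := (card_pair hne).symm
        _ ≤ _ := card_le_card (by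
          intro z hz
          rcases mem_insert.1 hz with rfl | hz
          · exact hz₁P
          · rw [mem_singleton.1 hz]; exact hz₂P)
  have hfib : ∀ z ∈ PAY, (Es.filter fun v => dist v.1 z = 1).card ≤ 11 * 12 := by
    intro z hz
    obtain ⟨hzX, hdeg, -, -⟩ := mem_filter.1 hz
    have hcov : (Es.filter fun v => dist v.1 z = 1) ⊆ (X.filter fun q => dist z q = 1).biUnion fun b => Rb b := by
      intro v hv
      obtain ⟨hvEs, hdz⟩ := mem_filter.1 hv
      have hvE : v ∈ E := (mem_filter.1 hvEs).1
      rw [mem_biUnion]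
      refine ⟨v.1, mem_filter.2 ⟨((hW v).1 ((hEmem v).1 hvE).1).1, by rw [dist_comm]; exact hdz⟩, hERb v hvE⟩
    calc (Es.filter fun v => dist v.1 z = 1).card
        ≤ ((X.filter fun q => dist z q = 1).biUnion fun b => Rb b).card := card_le_card hcov
      _ ≤ ∑ b ∈ X.filter (fun q => dist z q = 1), (Rb b).card := card_biUnion_le
      _ ≤ ∑ b ∈ X.filter (fun q => dist z q = 1), 12 := sum_le_sum fun b _ => hRb12 b
      _ = 12 * (X.filter fun q => dist z q = 1).card := by rw [sum_const, smul_eq_mul, mul_comm]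
      _ ≤ 11 * 12 := by omega
  have hEs_le : 2 * Es.card ≤ 132 * PAY.card := by
    have hdc := Finset.sum_card_bipartiteAbove_eq_sum_card_bipartiteBelow
      (s := Es) (t := PAY) (r := fun v z => dist v.1 z = 1)
    calc 2 * Es.card = ∑ v ∈ Es, 2 := by rw [sum_const, smul_eq_mul, mul_comm]
      _ ≤ ∑ v ∈ Es, (PAY.bipartiteAbove (fun v z => dist v.1 z = 1) v).card := sum_le_sum fun v hv => hEs_two v hv
      _ = ∑ z ∈ PAY, (Es.bipartiteBelow (fun v z => dist v.1 z = 1) z).card := hdc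
      _ ≤ ∑ z ∈ PAY, 11 * 12 := sum_le_sum fun z hz => hfib z hz
      _ = 132 * PAY.card := by rw [sum_const, smul_eq_mul]; ring
  have hEcard : E.card ≤ 78 * PAY.card := by omega
  exact hkey.trans (by omega)

end Instance

end Summit.Ventures.Crystal3D.Theorems

end
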